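import Summits.QuantumFields.YangMills.Theorems.LocalInsertionBoxConcentrationBounded
import HarnessLib

/-!
# Crux `HistoryTailL` (stmt-QuantumFields-19936), line «poincare_lipschitz» (#12, `Cruxes/HistoryTailL/Lines/poincare_lipschitz.lean`):
# ITS STUB `stub_boundedBoxConcentration` — K1 AT THE BOUNDED BOX SIDES `n ≤ 17·L³` — PROVED, by instantiation of ★w7-19936 g10's
# `LocalInsertion.BoxConcentrationBounded.boxConcentration_bounded` at `N₀ := 17·L³`

Cell `ym3-torus` (YM ladder rung R3 = continuum SU(2) Yang–Mills on the three-torus — a RUNG, NOT the Clay problem: not d = 4, not infinite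
volume, not a mass gap), LEAD seat `ym-ust-19936-w1` gen 8; `--supports stmt-QuantumFields-19936 --as helper`; THEOREMS ONLY, definition-free.

WHY.  Line #12 splits crux K1 = `PoincareLipschitz.MesoscopicConcentrationL` (stmt-QuantumFields-23532) by box side: `stub_boundedBoxConcentration`
(`n ≤ 17·L³`, the sides that heights `j ≤ 3` read) and `stub_mesoscopicBoxConcentration` (`17·L³ < n ≤ β_K`, organ-adjacent), composed by its
`MesoscopicConcentrationL_of`.  The bounded half is a LEVEL-0 statement: comb∕axial gauge on the box (✓p693190 `…BoxAxialLipschitz`, over lit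
✓`T4AxialGaugeSmallField`) + the prefactor-free single-plaquette tail ✓p691265 + a union bound over the `≤ 9n³` box plaquettes + centring, with constants
depending on `(L, N₀)` only — ★w7-19936 g10's ✓`boxConcentration_bounded : ∀ L N₀, …` = K1's text with ONE displayed guard `n ≤ N₀`.  THIS FILE is the
registered text VERBATIM (statement byte-identical to the skeleton's :28–29), obtained at `N₀ := 17·L³` with the guard moved past the `β_K`∕`sitesPerDir`
binders.  The mesoscopic half — the real content of K1 — is untouched.

* ★★★ `stub_boundedBoxConcentration` — the registered signature, no hypotheses.
HONEST SCOPE.  A one-line instantiation; nothing of `stub_mesoscopicBoxConcentration`, `MesoscopicConcentrationL` (23532), `BlockLipschitzL`, `HistoryTailL`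
or any summit statement is proved.  YM₃ on T³ is rung R3, NOT the Clay problem.

References: T. Bałaban, Commun. Math. Phys. **102** (1985) 255–275 [Balaban1985UV3] ((3) p.256, (7) p.257).
-/

set_option autoImplicit false

noncomputable section

namespace Summit.QuantumFields.YangMills.Theorems.PoincareLipschitzStubBoundedBoxConcentration

open Summit.QuantumFields.YangMills.Theorems.LocalInsertion.BoxConcentrationBounded (boxConcentration_bounded)

/-- ★★★ **`stub_boundedBoxConcentration` OF LINE «poincare_lipschitz» (#12), VERBATIM, PROVED** — K1's text (`PoincareLipschitz.MesoscopicConcentrationL`,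
stmt-QuantumFields-23532) restricted to the BOUNDED box sides `n ≤ 17·L³`: for every `L` there are `Cc ≥ 0`, `cc > 0`, `γ₁ ∈ (0, 1]` such that for every
family `F` (`F.L = L`), `0 < γ ≤ γ₁`, every cut-off `K`, every side `1 ≤ n ≤ 17L³` with `n ≤ β_K`, `2n ≤ sitesPerDir`, every corner `x₀`, every measurable
gauge-invariant `f` local in the box and `Λ`-Lipschitz in the link metric, and every `r ≥ 0`:
`Gibbs_K{r ≤ f − ∫f} ≤ Cc·exp(−cc·β_K·r²∕(n²Λ²))`.  = ✓`boxConcentration_bounded L (17 * L ^ 3)` with the guard moved.  The mesoscopic sides are NOT covered.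
[cite: Balaban1985UV3, (3) p.256 and (7) p.257] -/
theorem stub_boundedBoxConcentration :
    open Literature.MathematicalPhysics.QuantumFieldTheory.Balaban1983to89 Literature.MathematicalPhysics.QuantumFieldTheory.Balaban1983to89.T3ContinuumYM3Torus in ∀ (L : ℕ), ∃ (Cc cc : ℝ), 0 ≤ Cc ∧ 0 < cc ∧ ∃ γ₁ : ℝ, 0 < γ₁ ∧ γ₁ ≤ 1 ∧ ∀ (F : T3Family) (γ : ℝ), F.L = L → 0 < γ → γ ≤ γ₁ → ∀ (K n : ℕ), 1 ≤ n → (n : ℝ) ≤ (F.scheme T3UnitLawDensityEML.ℰp γ).β K → 2 * n ≤ (F.P K).sitesPerDir 0 → n ≤ 17 * L ^ 3 → ∀ (x₀ : Site (F.P K) 0) (f : GaugeField (F.P K) 0 (Matrix.specialUnitaryGroup (Fin 2) ℂ) → ℝ) (Λ : ℝ), 0 < Λ → Measurable f → GaugeField.GaugeInvariant f → (∀ U U' : GaugeField (F.P K) 0 (Matrix.specialUnitaryGroup (Fin 2) ℂ), (∀ b : PBond (F.P K) 0, (∀ k, (b.src k - x₀ k).val < n) → (∀ k, (b.tgt k -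 x₀ k).val < n) → U b = U' b) → f U = f U') → (∀ U U' : GaugeField (F.P K) 0 (Matrix.specialUnitaryGroup (Fin 2) ℂ), |f U - f U'| ≤ Λ * Real.sqrt (∑ b : PBond (F.P K) 0, GaugeGroup.dist1 (U b * (U' b)⁻¹) ^ 2)) → ∀ r : ℝ, 0 ≤ r → (T3UnitScaleTilt.gibbsK F T3UnitLawDensityEML.ℰp γ K).real {U | r ≤ f U - ∫ V, f V ∂(T3UnitScaleTilt.gibbsK F T3UnitLawDensityEML.ℰp γ K)} ≤ Cc * Real.exp (-(cc * (F.scheme T3UnitLawDensityEML.ℰp γ).β K * r ^ 2 / ((n : ℝ) ^ 2 * Λ ^ 2))) := by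
  intro L
  obtain ⟨Cc, cc, hCc, hcc, γ₁, hγ₁, hγ₁1, H⟩ := boxConcentration_bounded L (17 * L ^ 3)
  exact ⟨Cc, cc, hCc, hcc, γ₁, hγ₁, hγ₁1, fun F γ hFL hγ hγle K n h1n hnβ h2n hn17 =>
    H F γ hFL hγ hγle K n h1n hn17 hnβ h2n⟩

end Summit.QuantumFields.YangMills.Theorems.PoincareLipschitzStubBoundedBoxConcentration

end
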